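import Literature.Analysis.FluidPDE.AsymBurgersEvenPositivity
import Literature.Analysis.FluidPDE.RadialMeanHardyBound
import HarnessLib

/-!
# The radial part: circular means of `(L + λM − αΛ)w` and the integrated radial ODE

Analysis/FluidPDE file (all results proved). For `w ∈ C²_c(ℝ²)` put (un-normalised circular sums)

  `m(r) = ∫_{-π}^{π} w(r cos θ, r sin θ) dθ`,  `𝒜(r) = ∫ cos 2θ · w(circlePt r θ) dθ`,
  `F̄(r) = ∫ f(circlePt r θ) dθ`,  `f = L_λ w − αΛw`.

Averaging `f` over circles kills `Λw` (`v^G·∇w = c(r)∂_θw`, and `⟪K∗w, x⟫` has zero circular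
means) and turns `L + λM` into the radial operator plus the `cos 2θ`-moment:

  `F̄ = m'' + m'/r + (r/2) m' + m + (λ/2)(r𝒜' + 2𝒜)`,

so that `Φ(r) = r m' + r²m/2 + (λ/2) r²𝒜` has `Φ' = rF̄`, `Φ(0) = 0`, and finally

  `e^{r²/4} m(r) = e^{1/4} m(1) + ∫_1^r e^{s²/4} (𝓕(s) − (λ/2)s²𝒜(s))/s ds`, `𝓕(s) = ∫_0^s tF̄`.

Together with `∫_0^R tF̄ = 0` and `∫_0^R r m = ∫ w` (`R` beyond the support) these are exactly the
hypotheses of `radialMean_weighted_sq_le` (`RadialMeanHardyBound`). This is the radial half of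
Maekawa's inverse bound (Maekawa 2009, §4, proof of Lemma 4.1), made explicit.

## References

* Y. Maekawa, *Existence of asymmetric Burgers vortices and their asymptotic behavior at large
  circulations*, Math. Models Methods Appl. Sci. 19 (2009), §4. [Maekawa2009b]
* Th. Gallay, C. E. Wayne, *Global stability of vortex solutions of the two-dimensional
  Navier–Stokes equation*, Comm. Math. Phys. 255 (2005), §4 (radial inversion of `L`).
-/

noncomputable section

open Set Function Filter MeasureTheory Metric Real
open scoped InnerProductSpace RealInnerProductSpace Topology Laplacian

namespace Literature.Analysis.FluidPDE

/-! ### Circle-point calculus -/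

/-- `circlePt r θ = r • circlePt 1 θ`. [folklore] -/
theorem circlePt_eq_smul_circlePt_one (r θ : ℝ) : circlePt r θ = r • circlePt 1 θ := by
  ext i; fin_cases i <;> simp [circlePt]

/-- `(circlePt r θ)^⊥ = circlePt r (θ + π/2)`. [folklore] -/
theorem perp_circlePt_eq (r θ : ℝ) : perp (circlePt r θ) = circlePt r (θ + π / 2) := by
  ext i; fin_cases i <;> simp [circlePt, perp, Real.cos_add_pi_div_two, Real.sin_add_pi_div_two]

/-- `circlePt r π = circlePt r (-π)`. [folklore] -/
theorem circlePt_pi_eq_neg_pi (r : ℝ) : circlePt r π = circlePt r (-π) := by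
  ext i; fin_cases i <;> simp [circlePt]

/-- `circlePt 1 θ = cos θ • e₀ + sin θ • e₁`. [folklore] -/
theorem circlePt_one_eq (θ : ℝ) :
    circlePt 1 θ = Real.cos θ • EuclideanSpace.single 0 (1 : ℝ) + Real.sin θ • EuclideanSpace.single 1 (1 : ℝ) := by
  rw [circlePt_eq_smul_single]; simp

/-- The reflected point `(x₀, −x₁) = cos 2θ · x − sin 2θ · x^⊥` at `x = circlePt r θ`. [folklore] -/
theorem reflect_circlePt_eq (r θ : ℝ) :
    (circlePt r θ) 0 • EuclideanSpace.single 0 (1 : ℝ) - (circlePt r θ) 1 • EuclideanSpace.single 1 (1 : ℝ) =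
      Real.cos (2 * θ) • circlePt r θ - Real.sin (2 * θ) • perp (circlePt r θ) := by
  have hcs := Real.cos_sq_add_sin_sq θ
  ext i; fin_cases i
  · simp [circlePt, perp, Real.cos_two_mul, Real.sin_two_mul]
    linear_combination (-(2 * r * Real.cos θ)) * hcs
  · simp [circlePt, perp, Real.cos_two_mul, Real.sin_two_mul]
    ring

/-- Radial derivative along a ray: `d/dr g(circlePt r θ) = Dg(circlePt r θ)[circlePt 1 θ]`.
[folklore] -/
theorem hasDerivAt_comp_circlePt_left {g : EuclideanSpace ℝ (Fin 2) → ℝ} (hg : Differentiable ℝ g)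
    (r θ : ℝ) :
    HasDerivAt (fun s : ℝ => g (circlePt s θ)) (fderiv ℝ g (circlePt r θ) (circlePt 1 θ)) r := by
  have h1 : HasDerivAt (fun s : ℝ => circlePt s θ) (circlePt 1 θ) r := by
    have h := (hasDerivAt_id r).smul_const (circlePt 1 θ)
    simp only [one_smul] at h
    refine h.congr_of_eventuallyEq (Eventually.of_forall fun s => ?_)
    simp [circlePt_eq_smul_circlePt_one s θ]
  exact (hg _).hasFDerivAt.comp_hasDerivAt r h1

/-- **Differentiation under the circular integral.** For `g ∈ C¹_c` and continuous `φ`,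
`d/dr ∫ φ(t) g(circlePt r t) dt = ∫ φ(t) Dg(circlePt r t)[circlePt 1 t] dt`. [folklore] -/
theorem hasDerivAt_integral_mul_comp_circlePt {g : EuclideanSpace ℝ (Fin 2) → ℝ} (hg : ContDiff ℝ 1 g)
    (hgc : HasCompactSupport g) {φ : ℝ → ℝ} (hφ : Continuous φ) (r : ℝ) :
    HasDerivAt (fun s : ℝ => ∫ t in (-π)..π, φ t * g (circlePt s t))
      (∫ t in (-π)..π, φ t * fderiv ℝ g (circlePt r t) (circlePt 1 t)) r := by
  have hgd : Differentiable ℝ g := hg.differentiable one_ne_zero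
  have hgf : Continuous (fderiv ℝ g) := hg.continuous_fderiv one_ne_zero
  obtain ⟨C, hC⟩ := hgf.bounded_above_of_compact_support (hgc.fderiv (𝕜 := ℝ))
  have hcont : ∀ s : ℝ, Continuous fun t : ℝ => φ t * g (circlePt s t) := fun s =>
    hφ.mul (hg.continuous.comp (continuous_circlePt s))
  have hcont' : ∀ s : ℝ, Continuous fun t : ℝ => φ t * fderiv ℝ g (circlePt s t) (circlePt 1 t) := fun s =>
    hφ.mul ((hgf.comp (continuous_circlePt s)).clm_apply (continuous_circlePt 1))
  have hbc : Continuous fun t : ℝ => |φ t| * C := (continuous_abs.comp hφ).mul continuous_const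
  have h : IntervalIntegrable (fun t : ℝ => φ t * fderiv ℝ g (circlePt r t) (circlePt 1 t)) volume (-π) π ∧
      HasDerivAt (fun s : ℝ => ∫ t in (-π)..π, φ t * g (circlePt s t))
        (∫ t in (-π)..π, φ t * fderiv ℝ g (circlePt r t) (circlePt 1 t)) r :=
    intervalIntegral.hasDerivAt_integral_of_dominated_loc_of_deriv_le
    (F := fun (s t : ℝ) => φ t * g (circlePt s t))
    (F' := fun (s t : ℝ) => φ t * fderiv ℝ g (circlePt s t) (circlePt 1 t))
    (bound := fun t => |φ t| * C) univ_mem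
    (Eventually.of_forall fun s => (hcont s).aestronglyMeasurable) ((hcont r).intervalIntegrable _ _)
    (hcont' r).aestronglyMeasurable
    (Eventually.of_forall fun t _ s _ => by
      rw [Real.norm_eq_abs, abs_mul]
      refine mul_le_mul_of_nonneg_left ?_ (abs_nonneg _)
      calc |fderiv ℝ g (circlePt s t) (circlePt 1 t)| ≤ ‖fderiv ℝ g (circlePt s t)‖ * ‖circlePt 1 t‖ :=
            (fderiv ℝ g (circlePt s t)).le_opNorm _
        _ ≤ C * 1 := by
            rw [norm_circlePt, abs_one]
            exact mul_le_mul_of_nonneg_right (hC _) zero_le_one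
        _ = C := mul_one C)
    (hbc.intervalIntegrable _ _)
    (Eventually.of_forall fun t _ s _ => (hasDerivAt_comp_circlePt_left hgd s t).const_mul (φ t))
  exact h.2

/-- The Laplacian of a `C²` function in terms of `D²w(x)`: `Δw = D²w[e₀][e₀] + D²w[e₁][e₁]`
(private copy for `C²`, see `GaussianVortexPlanarLinear.laplacian_eq_fin_two`). [folklore] -/
private theorem laplacian_eq_fderiv_fderiv_fin_two (φ : EuclideanSpace ℝ (Fin 2) → ℝ) (x : EuclideanSpace ℝ (Fin 2)) :
    Δ φ x = fderiv ℝ (fderiv ℝ φ) x (EuclideanSpace.single 0 1) (EuclideanSpace.single 0 1) +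
      fderiv ℝ (fderiv ℝ φ) x (EuclideanSpace.single 1 1) (EuclideanSpace.single 1 1) := by
  have h := congrFun (InnerProductSpace.laplacian_eq_iteratedFDeriv_orthonormalBasis φ
    (EuclideanSpace.basisFun (Fin 2) ℝ)) x
  rw [h]
  simp only [Fin.sum_univ_two, EuclideanSpace.basisFun_apply]
  have h2 : ∀ v : EuclideanSpace ℝ (Fin 2), iteratedFDeriv ℝ 2 φ x ![v, v] = fderiv ℝ (fderiv ℝ φ) x v v := by
    intro v
    rw [iteratedFDeriv_two_apply]
    simp
  rw [h2, h2]

/-- Rotation invariance of the trace of a bilinear form on `ℝ²`: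
`B[u][u] + B[u^⊥][u^⊥] = B[e₀][e₀] + B[e₁][e₁]` for the unit vector `u = circlePt 1 t`. [folklore] -/
theorem bilin_circlePt_add_perp (B : EuclideanSpace ℝ (Fin 2) →L[ℝ] EuclideanSpace ℝ (Fin 2) →L[ℝ] ℝ) (t : ℝ) :
    B (circlePt 1 t) (circlePt 1 t) + B (perp (circlePt 1 t)) (perp (circlePt 1 t)) =
      B (EuclideanSpace.single 0 1) (EuclideanSpace.single 0 1) + B (EuclideanSpace.single 1 1) (EuclideanSpace.single 1 1) := by
  rw [perp_circlePt_eq_smul_single, circlePt_one_eq]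
  simp only [map_add, map_smul, _root_.add_apply, FunLike.coe_smul, Pi.smul_apply, smul_eq_mul, one_mul,
    neg_mul]
  have hcs := Real.cos_sq_add_sin_sq t
  linear_combination (B (EuclideanSpace.single 0 1) (EuclideanSpace.single 0 1) +
    B (EuclideanSpace.single 1 1) (EuclideanSpace.single 1 1)) * hcs

/-- **Angular second derivative.** For `w ∈ C²`, `θ ↦ Dw(x)[x^⊥]` (`x = circlePt r θ`) has derivative
`D²w(x)[x^⊥][x^⊥] − Dw(x)[x]`. [folklore] -/
theorem hasDerivAt_fderiv_perp_circlePt {w : EuclideanSpace ℝ (Fin 2) → ℝ} (hw : ContDiff ℝ 2 w) (r θ : ℝ) :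
    HasDerivAt (fun θ : ℝ => fderiv ℝ w (circlePt r θ) (perp (circlePt r θ)))
      (fderiv ℝ (fderiv ℝ w) (circlePt r θ) (perp (circlePt r θ)) (perp (circlePt r θ)) -
        fderiv ℝ w (circlePt r θ) (circlePt r θ)) θ := by
  have hd : Differentiable ℝ (fderiv ℝ w) := (hw.fderiv_right (m := 1) (by norm_num)).differentiable one_ne_zero
  have hc : HasDerivAt (fun θ : ℝ => fderiv ℝ w (circlePt r θ))
      (fderiv ℝ (fderiv ℝ w) (circlePt r θ) (perp (circlePt r θ))) θ :=
    (hd _).hasFDerivAt.comp_hasDerivAt θ (hasDerivAt_circlePt r θ)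
  have hu : HasDerivAt (fun θ : ℝ => perp (circlePt r θ)) (-circlePt r θ) θ := by
    have h1 : HasDerivAt (fun θ : ℝ => circlePt r (θ + π / 2)) (perp (circlePt r (θ + π / 2))) θ :=
      (hasDerivAt_circlePt r (θ + π / 2)).comp_add_const θ (π / 2)
    rw [← perp_circlePt_eq, perp_perp] at h1
    refine h1.congr_of_eventuallyEq (Eventually.of_forall fun t => ?_)
    exact perp_circlePt_eq r t
  have h := hc.clm_apply hu
  simpa [sub_eq_add_neg] using h

/-- `Dw(x)[x] = r Dw(x)[u]` at `x = circlePt r θ`, `u = circlePt 1 θ`. [folklore] -/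
theorem fderiv_apply_circlePt_self (w : EuclideanSpace ℝ (Fin 2) → ℝ) (r θ : ℝ) :
    fderiv ℝ w (circlePt r θ) (circlePt r θ) = r * fderiv ℝ w (circlePt r θ) (circlePt 1 θ) := by
  have e := congrArg (fderiv ℝ w (circlePt r θ)) (circlePt_eq_smul_circlePt_one r θ)
  rw [map_smul, smul_eq_mul] at e
  exact e

/-- **The Laplacian in polar form, pointwise.** For `x = circlePt r θ`, `r ≠ 0`:
`Δw(x) = D²w(x)[u][u] + r⁻² (d/dθ (Dw(x)[x^⊥]) + r Dw(x)[u])`, `u = circlePt 1 θ`, written with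
the derivative expression of `hasDerivAt_fderiv_perp_circlePt`. [folklore] -/
theorem laplacian_circlePt_eq (w : EuclideanSpace ℝ (Fin 2) → ℝ) {r : ℝ} (hr : r ≠ 0) (θ : ℝ) :
    Δ w (circlePt r θ) = fderiv ℝ (fderiv ℝ w) (circlePt r θ) (circlePt 1 θ) (circlePt 1 θ) +
      (r ^ 2)⁻¹ * (fderiv ℝ (fderiv ℝ w) (circlePt r θ) (perp (circlePt r θ)) (perp (circlePt r θ)) -
        fderiv ℝ w (circlePt r θ) (circlePt r θ)) + r⁻¹ * fderiv ℝ w (circlePt r θ) (circlePt 1 θ) := by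
  rw [laplacian_eq_fderiv_fderiv_fin_two w, ← bilin_circlePt_add_perp _ θ]
  have h1 : perp (circlePt r θ) = r • perp (circlePt 1 θ) := by
    rw [circlePt_eq_smul_circlePt_one r θ, perp_smul]
  rw [h1, fderiv_apply_circlePt_self, map_smul, map_smul, FunLike.coe_smul, Pi.smul_apply, smul_eq_mul, smul_eq_mul]
  field_simp
  ring

/-- `x₀∂₀w + x₁∂₁w = Dw(x)[x] = r Dw(x)[u]` at `x = circlePt r θ`. [folklore] -/
theorem drift_circlePt_eq (w : EuclideanSpace ℝ (Fin 2) → ℝ) (r θ : ℝ) :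
    (circlePt r θ) 0 * fderiv ℝ w (circlePt r θ) (EuclideanSpace.single 0 1) +
      (circlePt r θ) 1 * fderiv ℝ w (circlePt r θ) (EuclideanSpace.single 1 1) =
      r * fderiv ℝ w (circlePt r θ) (circlePt 1 θ) := by
  have hx : circlePt r θ = (circlePt r θ) 0 • EuclideanSpace.single 0 (1 : ℝ) + (circlePt r θ) 1 • EuclideanSpace.single 1 (1 : ℝ) := by
    ext i; fin_cases i <;> simp
  have e := congrArg (fderiv ℝ w (circlePt r θ)) hx
  rw [map_add, map_smul, map_smul, smul_eq_mul, smul_eq_mul] at e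
  rw [← fderiv_apply_circlePt_self, e]

/-- `x₀∂₀w − x₁∂₁w = r cos 2θ Dw(x)[u] − sin 2θ Dw(x)[x^⊥]` at `x = circlePt r θ`. [folklore] -/
theorem strain_circlePt_eq (w : EuclideanSpace ℝ (Fin 2) → ℝ) (r θ : ℝ) :
    (circlePt r θ) 0 * fderiv ℝ w (circlePt r θ) (EuclideanSpace.single 0 1) -
      (circlePt r θ) 1 * fderiv ℝ w (circlePt r θ) (EuclideanSpace.single 1 1) =
      r * (Real.cos (2 * θ) * fderiv ℝ w (circlePt r θ) (circlePt 1 θ)) -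
        Real.sin (2 * θ) * fderiv ℝ w (circlePt r θ) (perp (circlePt r θ)) := by
  have h : fderiv ℝ w (circlePt r θ) ((circlePt r θ) 0 • EuclideanSpace.single 0 (1 : ℝ) -
      (circlePt r θ) 1 • EuclideanSpace.single 1 (1 : ℝ)) =
      (circlePt r θ) 0 * fderiv ℝ w (circlePt r θ) (EuclideanSpace.single 0 1) -
        (circlePt r θ) 1 * fderiv ℝ w (circlePt r θ) (EuclideanSpace.single 1 1) := by
    rw [map_sub, map_smul, map_smul, smul_eq_mul, smul_eq_mul]
  rw [← h, reflect_circlePt_eq, map_sub, map_smul, map_smul, smul_eq_mul, smul_eq_mul, fderiv_apply_circlePt_self]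
  ring

/-- `G(circlePt r θ) = (4π)⁻¹ e^{−r²/4}` and `Φ(‖circlePt r θ‖) = Φ(|r|)`: the angular velocity
`Ω = G/(2Φ)` is constant on circles. [folklore] -/
theorem omega_circlePt_eq (r θ : ℝ) :
    gaussVortexProfile (circlePt r θ) / (2 * kerWeight ‖circlePt r θ‖) =
      (4 * π)⁻¹ * Real.exp (-(r ^ 2 / 4)) / (2 * kerWeight |r|) := by
  rw [gaussVortexProfile, norm_circlePt, sq_abs]

/-- **`Λw` has zero circular sums**: `∫ Λw(circlePt r θ) dθ = 0`, since `Λw = Ω ∂_θ(w + Φψ)` with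
`Ω` constant on circles. [cite: Maekawa2009b, Lemma 1.1] -/
theorem integral_gaussLambda_circlePt {w : EuclideanSpace ℝ (Fin 2) → ℝ} (hw : ContDiff ℝ 2 w)
    (hwc : HasCompactSupport w) (r : ℝ) :
    ∫ θ in (-π)..π, (⟪gaussVortexVelocity (circlePt r θ), gradient w (circlePt r θ)⟫ +
      ⟪biotSavart2D w (circlePt r θ), gradient gaussVortexProfile (circlePt r θ)⟫) = 0 := by
  have hu : Differentiable ℝ fun y => w y + kerWeight ‖y‖ * ∫ z, w z * ((2 * π)⁻¹ * Real.log ‖y - z‖) :=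
    (contDiff_one_corrected hw hwc).differentiable one_ne_zero
  simp_rw [gaussLambda_eq_omega_mul_fderiv_corrected_perp hw hwc, omega_circlePt_eq]
  rw [intervalIntegral.integral_const_mul, intervalIntegral.integral_eq_sub_of_hasDerivAt
    (fun θ _ => hasDerivAt_comp_circlePt hu r θ)
    ((continuous_fderiv_comp_circlePt_perp (contDiff_one_corrected hw hwc) r).intervalIntegrable _ _),
    circlePt_pi_eq_neg_pi, sub_self, mul_zero]

/-! ### Circular sums of the pieces of `L_λ` -/

section Sums

variable {w : EuclideanSpace ℝ (Fin 2) → ℝ}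

/-- Continuity of `t ↦ D²w(circlePt r t)[a(t)][b(t)]` for continuous directions. [folklore] -/
theorem continuous_fderiv_fderiv_circlePt (hw : ContDiff ℝ 2 w) (r : ℝ) {a b : ℝ → EuclideanSpace ℝ (Fin 2)}
    (ha : Continuous a) (hb : Continuous b) :
    Continuous fun t : ℝ => fderiv ℝ (fderiv ℝ w) (circlePt r t) (a t) (b t) :=
  (((((hw.fderiv_right (m := 1) (by norm_num)).continuous_fderiv one_ne_zero).comp
    (continuous_circlePt r)).clm_apply ha).clm_apply hb)

/-- Continuity of `t ↦ Dw(circlePt r t)[a(t)]` for a continuous direction. [folklore] -/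
theorem continuous_fderiv_circlePt (hw : ContDiff ℝ 1 w) (r : ℝ) {a : ℝ → EuclideanSpace ℝ (Fin 2)}
    (ha : Continuous a) : Continuous fun t : ℝ => fderiv ℝ w (circlePt r t) (a t) :=
  ((hw.continuous_fderiv one_ne_zero).comp (continuous_circlePt r)).clm_apply ha

/-- **Circular sum of `Δw`**: `∫ Δw(circlePt r t) dt = M₂(r) + M₁(r)/r` (`r ≠ 0`), where
`M₁(r) = ∫ Dw[u]`, `M₂(r) = ∫ D²w[u][u]`, `u = circlePt 1 t`. [folklore] -/
theorem integral_laplacian_circlePt (hw : ContDiff ℝ 2 w) {r : ℝ} (hr : r ≠ 0) :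
    ∫ t in (-π)..π, Δ w (circlePt r t) = (∫ θ in (-π)..π, fderiv ℝ (fderiv ℝ w) (circlePt r θ) (circlePt 1 θ) (circlePt 1 θ)) + r⁻¹ * (∫ θ in (-π)..π, fderiv ℝ w (circlePt r θ) (circlePt 1 θ)) := by
  have hw1 : ContDiff ℝ 1 w := hw.of_le one_le_two
  have c2 : Continuous fun t : ℝ => fderiv ℝ (fderiv ℝ w) (circlePt r t) (circlePt 1 t) (circlePt 1 t) :=
    continuous_fderiv_fderiv_circlePt hw r (continuous_circlePt 1) (continuous_circlePt 1)
  have cθ : Continuous fun t : ℝ => fderiv ℝ (fderiv ℝ w) (circlePt r t) (perp (circlePt r t)) (perp (circlePt r t)) -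
      fderiv ℝ w (circlePt r t) (circlePt r t) :=
    (continuous_fderiv_fderiv_circlePt hw r (continuous_perp_circlePt r) (continuous_perp_circlePt r)).sub
      (continuous_fderiv_circlePt hw1 r (continuous_circlePt r))
  have c1 : Continuous fun t : ℝ => fderiv ℝ w (circlePt r t) (circlePt 1 t) :=
    continuous_fderiv_circlePt hw1 r (continuous_circlePt 1)
  have hθ : ∫ t in (-π)..π, (fderiv ℝ (fderiv ℝ w) (circlePt r t) (perp (circlePt r t)) (perp (circlePt r t)) -
      fderiv ℝ w (circlePt r t) (circlePt r t)) = 0 := by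
    rw [intervalIntegral.integral_eq_sub_of_hasDerivAt (fun t _ => hasDerivAt_fderiv_perp_circlePt hw r t)
      (cθ.intervalIntegrable _ _), circlePt_pi_eq_neg_pi, sub_self]
  have i1 : IntervalIntegrable (fun t : ℝ => fderiv ℝ (fderiv ℝ w) (circlePt r t) (circlePt 1 t) (circlePt 1 t) +
      (r ^ 2)⁻¹ * (fderiv ℝ (fderiv ℝ w) (circlePt r t) (perp (circlePt r t)) (perp (circlePt r t)) -
        fderiv ℝ w (circlePt r t) (circlePt r t))) volume (-π) π := (c2.add (cθ.const_mul _)).intervalIntegrable _ _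
  have i2 : IntervalIntegrable (fun t : ℝ => r⁻¹ * fderiv ℝ w (circlePt r t) (circlePt 1 t)) volume (-π) π :=
    (c1.const_mul _).intervalIntegrable _ _
  have i3 : IntervalIntegrable (fun t : ℝ => (r ^ 2)⁻¹ * (fderiv ℝ (fderiv ℝ w) (circlePt r t) (perp (circlePt r t))
      (perp (circlePt r t)) - fderiv ℝ w (circlePt r t) (circlePt r t))) volume (-π) π := (cθ.const_mul _).intervalIntegrable _ _
  rw [intervalIntegral.integral_congr fun t _ => laplacian_circlePt_eq w hr t,
    intervalIntegral.integral_add i1 i2, intervalIntegral.integral_add (c2.intervalIntegrable _ _) i3,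
    intervalIntegral.integral_const_mul, intervalIntegral.integral_const_mul, hθ, mul_zero, add_zero]

/-- **Circular sum of `x·∇w`**: `∫ (x₀∂₀w + x₁∂₁w)(circlePt r t) dt = r M₁(r)`. [folklore] -/
theorem integral_drift_circlePt (w : EuclideanSpace ℝ (Fin 2) → ℝ) (r : ℝ) :
    ∫ t in (-π)..π, ((circlePt r t) 0 * fderiv ℝ w (circlePt r t) (EuclideanSpace.single 0 1) +
      (circlePt r t) 1 * fderiv ℝ w (circlePt r t) (EuclideanSpace.single 1 1)) = r * (∫ θ in (-π)..π, fderiv ℝ w (circlePt r θ) (circlePt 1 θ)) := by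
  rw [intervalIntegral.integral_congr fun t _ => drift_circlePt_eq w r t, intervalIntegral.integral_const_mul]

/-- **Circular sum of `Mw`**: `∫ (x₀∂₀w − x₁∂₁w)(circlePt r t) dt = r 𝒜₁(r) + 2𝒜(r)`
(`𝒜 = ∫ cos 2t · w`, `𝒜₁ = ∫ cos 2t · Dw[u]`; integration by parts in the angle). [folklore] -/
theorem integral_strain_circlePt (hw : ContDiff ℝ 1 w) (r : ℝ) :
    ∫ t in (-π)..π, ((circlePt r t) 0 * fderiv ℝ w (circlePt r t) (EuclideanSpace.single 0 1) -
      (circlePt r t) 1 * fderiv ℝ w (circlePt r t) (EuclideanSpace.single 1 1)) = r * (∫ θ in (-π)..π, Real.cos (2 * θ) * fderiv ℝ w (circlePt r θ) (circlePt 1 θ)) + 2 * (∫ θ in (-π)..π, Real.cos (2 * θ) * w (circlePt r θ)) := by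
  have hd : Differentiable ℝ w := hw.differentiable one_ne_zero
  have c1 : Continuous fun t : ℝ => Real.cos (2 * t) * fderiv ℝ w (circlePt r t) (circlePt 1 t) :=
    (Real.continuous_cos.comp (continuous_const.mul continuous_id)).mul
      (continuous_fderiv_circlePt hw r (continuous_circlePt 1))
  have cθ : Continuous fun t : ℝ => fderiv ℝ w (circlePt r t) (perp (circlePt r t)) :=
    continuous_fderiv_circlePt hw r (continuous_perp_circlePt r)
  have c2 : Continuous fun t : ℝ => Real.sin (2 * t) * fderiv ℝ w (circlePt r t) (perp (circlePt r t)) :=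
    (Real.continuous_sin.comp (continuous_const.mul continuous_id)).mul cθ
  -- integration by parts: `∫ sin 2t ∂_t(w ∘ circlePt) = −∫ 2 cos 2t (w ∘ circlePt)`
  have hsin : ∀ t : ℝ, HasDerivAt (fun t : ℝ => Real.sin (2 * t)) (2 * Real.cos (2 * t)) t := fun t => by
    have h := ((hasDerivAt_id t).const_mul 2).sin
    simp only [id, mul_one] at h
    exact h.congr_deriv (by ring)
  have hibp := intervalIntegral.integral_mul_deriv_eq_deriv_mul (a := -π) (b := π)
    (fun t _ => hsin t) (fun t _ => hasDerivAt_comp_circlePt hd r t)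
    ((continuous_const.mul (Real.continuous_cos.comp (continuous_const.mul continuous_id))).intervalIntegrable _ _)
    (cθ.intervalIntegrable _ _)
  have hb1 : Real.sin (2 * π) = 0 := Real.sin_two_pi
  have hb2 : Real.sin (2 * -π) = 0 := by rw [mul_neg, Real.sin_neg, Real.sin_two_pi, neg_zero]
  rw [hb1, hb2, zero_mul, zero_mul, sub_zero, zero_sub] at hibp
  have h2 : ∫ t in (-π)..π, 2 * Real.cos (2 * t) * w (circlePt r t) = 2 * (∫ θ in (-π)..π, Real.cos (2 * θ) * w (circlePt r θ)) := by
    rw [← intervalIntegral.integral_const_mul]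
    exact intervalIntegral.integral_congr fun t _ => by ring
  rw [intervalIntegral.integral_congr fun t _ => strain_circlePt_eq w r t,
    intervalIntegral.integral_sub ((c1.const_mul r).intervalIntegrable _ _) (c2.intervalIntegrable _ _),
    intervalIntegral.integral_const_mul, hibp, h2]
  ring

/-! ### Radial derivatives of the circular sums -/

/-- `M₀' = M₁`: `d/dr ∫ w(circlePt r t) dt = ∫ Dw(circlePt r t)[u] dt`. [folklore] -/
theorem hasDerivAt_circSum (hw : ContDiff ℝ 1 w) (hwc : HasCompactSupport w) (r : ℝ) :
    HasDerivAt (fun s : ℝ => (∫ θ in (-π)..π, w (circlePt s θ))) (∫ θ in (-π)..π, fderiv ℝ w (circlePt r θ) (circlePt 1 θ)) r := by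
  have h := hasDerivAt_integral_mul_comp_circlePt hw hwc (φ := fun _ => (1 : ℝ)) continuous_const r
  simp only [one_mul] at h
  exact h

/-- `𝒜' = 𝒜₁`. [folklore] -/
theorem hasDerivAt_circCos (hw : ContDiff ℝ 1 w) (hwc : HasCompactSupport w) (r : ℝ) :
    HasDerivAt (fun s : ℝ => (∫ θ in (-π)..π, Real.cos (2 * θ) * w (circlePt s θ))) (∫ θ in (-π)..π, Real.cos (2 * θ) * fderiv ℝ w (circlePt r θ) (circlePt 1 θ)) r :=
  hasDerivAt_integral_mul_comp_circlePt hw hwc (Real.continuous_cos.comp (continuous_const.mul continuous_id)) r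

/-- `Dw(x)[u] = cos t ∂₀w(x) + sin t ∂₁w(x)` for `u = circlePt 1 t`. [folklore] -/
theorem fderiv_circlePt_one_eq (w : EuclideanSpace ℝ (Fin 2) → ℝ) (x : EuclideanSpace ℝ (Fin 2)) (t : ℝ) :
    fderiv ℝ w x (circlePt 1 t) = Real.cos t * fderiv ℝ w x (EuclideanSpace.single 0 1) +
      Real.sin t * fderiv ℝ w x (EuclideanSpace.single 1 1) := by
  rw [circlePt_one_eq, map_add, map_smul, map_smul, smul_eq_mul, smul_eq_mul]

/-- `M₁' = M₂`: `d/dr ∫ Dw(circlePt r t)[u] dt = ∫ D²w(circlePt r t)[u][u] dt` for `w ∈ C²_c`. [folklore] -/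
theorem hasDerivAt_circSum_fderiv (hw : ContDiff ℝ 2 w) (hwc : HasCompactSupport w) (r : ℝ) :
    HasDerivAt (fun s : ℝ => (∫ θ in (-π)..π, fderiv ℝ w (circlePt s θ) (circlePt 1 θ))) (∫ θ in (-π)..π, fderiv ℝ (fderiv ℝ w) (circlePt r θ) (circlePt 1 θ) (circlePt 1 θ)) r := by
  have hw1 : ContDiff ℝ 1 w := hw.of_le one_le_two
  have hdi : ∀ i : Fin 2, ContDiff ℝ 1 fun y => fderiv ℝ w y (EuclideanSpace.single i 1) := fun i =>
    (hw.fderiv_right (m := 1) (by norm_num)).clm_apply contDiff_const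
  have hds : ∀ i : Fin 2, HasCompactSupport fun y => fderiv ℝ w y (EuclideanSpace.single i 1) :=
    fun i => hwc.fderiv_apply (𝕜 := ℝ) _
  have hcos : Continuous fun t : ℝ => Real.cos t := Real.continuous_cos
  have hsin : Continuous fun t : ℝ => Real.sin t := Real.continuous_sin
  have e : (fun s : ℝ => (∫ θ in (-π)..π, fderiv ℝ w (circlePt s θ) (circlePt 1 θ))) = fun s =>
      (∫ t in (-π)..π, Real.cos t * fderiv ℝ w (circlePt s t) (EuclideanSpace.single 0 1)) +
        ∫ t in (-π)..π, Real.sin t * fderiv ℝ w (circlePt s t) (EuclideanSpace.single 1 1) := by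
    funext s
    rw [intervalIntegral.integral_congr fun t _ => fderiv_circlePt_one_eq w (circlePt s t) t,
      intervalIntegral.integral_add]
    · exact (hcos.mul ((hdi 0).continuous.comp (continuous_circlePt s))).intervalIntegrable _ _
    · exact (hsin.mul ((hdi 1).continuous.comp (continuous_circlePt s))).intervalIntegrable _ _
  rw [e]
  have h := (hasDerivAt_integral_mul_comp_circlePt (hdi 0) (hds 0) hcos r).add
    (hasDerivAt_integral_mul_comp_circlePt (hdi 1) (hds 1) hsin r)
  refine h.congr_deriv ?_
  have c0 : Continuous fun t : ℝ => Real.cos t * fderiv ℝ (fun y => fderiv ℝ w y (EuclideanSpace.single 0 1)) (circlePt r t) (circlePt 1 t) :=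
    hcos.mul (continuous_fderiv_circlePt (hdi 0) r (continuous_circlePt 1))
  have c1 : Continuous fun t : ℝ => Real.sin t * fderiv ℝ (fun y => fderiv ℝ w y (EuclideanSpace.single 1 1)) (circlePt r t) (circlePt 1 t) :=
    hsin.mul (continuous_fderiv_circlePt (hdi 1) r (continuous_circlePt 1))
  rw [← intervalIntegral.integral_add (c0.intervalIntegrable _ _) (c1.intervalIntegrable _ _)]
  refine intervalIntegral.integral_congr fun t _ => ?_
  have e2 := congrArg (fderiv ℝ (fderiv ℝ w) (circlePt r t) (circlePt 1 t)) (circlePt_one_eq t)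
  rw [map_add, map_smul, map_smul, smul_eq_mul, smul_eq_mul] at e2
  rw [fderiv_fderiv_apply_eq_of_contDiff_two hw, fderiv_fderiv_apply_eq_of_contDiff_two hw, e2]

/-! ### The averaged operator and the radial ODE -/

/-- `f = L_λ w − αΛw` is continuous for `w ∈ C²_c`. [folklore] -/
theorem continuous_operator (hw : ContDiff ℝ 2 w) (hwc : HasCompactSupport w) (lam α : ℝ) :
    Continuous fun x => (strainedVorticityOperator lam w x - α * (⟪gaussVortexVelocity x, gradient w x⟫ + ⟪biotSavart2D w x, gradient gaussVortexProfile x⟫)) :=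
  (continuous_strainedVorticityOperator_of_contDiff_two hw lam).sub (continuous_const.mul (continuous_gaussLambda hw hwc))

/-- Circular sums of a continuous function are continuous in the radius. [folklore] -/
theorem continuous_circSum {G : EuclideanSpace ℝ (Fin 2) → ℝ} (hG : Continuous G) {φ : ℝ → ℝ} (hφ : Continuous φ) :
    Continuous fun r : ℝ => ∫ t in (-π)..π, φ t * G (circlePt r t) := by
  have h : Continuous (uncurry fun (r t : ℝ) => φ t * G (circlePt r t)) :=
    (hφ.comp continuous_snd).mul (hG.comp continuous_circlePt_uncurry)
  exact intervalIntegral.continuous_parametric_intervalIntegral_of_continuous' h (-π) π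

/-- Circular sums of a continuous function are continuous in the radius (no weight). [folklore] -/
theorem continuous_circSum' {G : EuclideanSpace ℝ (Fin 2) → ℝ} (hG : Continuous G) :
    Continuous fun r : ℝ => ∫ t in (-π)..π, G (circlePt r t) := by
  have h := continuous_circSum hG (φ := fun _ => (1 : ℝ)) continuous_const
  simp only [one_mul] at h
  exact h

/-- **The averaged operator.** For `r ≠ 0`,
`∫ f(circlePt r t) dt = M₂ + M₁/r + (r/2)M₁ + M₀ + (λ/2)(r𝒜₁ + 2𝒜)`, `f = L_λw − αΛw`.
[cite: Maekawa2009b, §4 Lemma 4.1 (radial part)] -/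
theorem circSum_operator_eq (hw : ContDiff ℝ 2 w) (hwc : HasCompactSupport w) (lam α : ℝ) {r : ℝ} (hr : r ≠ 0) :
    (∫ θ in (-π)..π, (strainedVorticityOperator lam w (circlePt r θ) - α * (⟪gaussVortexVelocity (circlePt r θ), gradient w (circlePt r θ)⟫ + ⟪biotSavart2D w (circlePt r θ), gradient gaussVortexProfile (circlePt r θ)⟫))) = (∫ θ in (-π)..π, fderiv ℝ (fderiv ℝ w) (circlePt r θ) (circlePt 1 θ) (circlePt 1 θ)) + r⁻¹ * (∫ θ in (-π)..π, fderiv ℝ w (circlePt r θ) (circlePt 1 θ)) + r / 2 * (∫ θ in (-π)..π, fderiv ℝ w (circlePt r θ) (circlePt 1 θ)) + (∫ θ in (-π)..π, w (circlePt r θ)) + lam / 2 * (r * (∫ θ in (-π)..π, Real.cos (2 * θ) * fderiv ℝ w (circlePt r θ) (circlePt 1 θ)) + 2 * (∫ θ in (-π)..π, Real.cos (2 * θ) * w (circlePt r θ))) := by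
  have hw1 : ContDiff ℝ 1 w := hw.of_le one_le_two
  -- pointwise decomposition of `f`
  have hpt : ∀ x : EuclideanSpace ℝ (Fin 2), (strainedVorticityOperator lam w x - α * (⟪gaussVortexVelocity x, gradient w x⟫ + ⟪biotSavart2D w x, gradient gaussVortexProfile x⟫)) =
      Δ w x + 1 / 2 * (x 0 * fderiv ℝ w x (EuclideanSpace.single 0 1) + x 1 * fderiv ℝ w x (EuclideanSpace.single 1 1)) +
        lam / 2 * (x 0 * fderiv ℝ w x (EuclideanSpace.single 0 1) - x 1 * fderiv ℝ w x (EuclideanSpace.single 1 1)) +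
        w x - α * (⟪gaussVortexVelocity x, gradient w x⟫ + ⟪biotSavart2D w x, gradient gaussVortexProfile x⟫) := by
    intro x; simp only [strainedVorticityOperator]; ring
  -- continuity of the pieces along the circle
  have hΔ : Continuous fun t : ℝ => Δ w (circlePt r t) := by
    have e : (fun t : ℝ => Δ w (circlePt r t)) = fun t => fderiv ℝ (fderiv ℝ w) (circlePt r t) (EuclideanSpace.single 0 1)
        (EuclideanSpace.single 0 1) + fderiv ℝ (fderiv ℝ w) (circlePt r t) (EuclideanSpace.single 1 1) (EuclideanSpace.single 1 1) :=
      funext fun t => laplacian_eq_fderiv_fderiv_fin_two w _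
    rw [e]
    exact (continuous_fderiv_fderiv_circlePt hw r continuous_const continuous_const).add
      (continuous_fderiv_fderiv_circlePt hw r continuous_const continuous_const)
  have hco : ∀ i : Fin 2, Continuous fun t : ℝ => (circlePt r t) i * fderiv ℝ w (circlePt r t) (EuclideanSpace.single i 1) :=
    fun i => ((PiLp.continuous_apply 2 _ i).comp (continuous_circlePt r)).mul (continuous_fderiv_circlePt hw1 r continuous_const)
  have hdr : Continuous fun t : ℝ => 1 / 2 * ((circlePt r t) 0 * fderiv ℝ w (circlePt r t) (EuclideanSpace.single 0 1) +
      (circlePt r t) 1 * fderiv ℝ w (circlePt r t) (EuclideanSpace.single 1 1)) := continuous_const.mul ((hco 0).add (hco 1))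
  have hst : Continuous fun t : ℝ => lam / 2 * ((circlePt r t) 0 * fderiv ℝ w (circlePt r t) (EuclideanSpace.single 0 1) -
      (circlePt r t) 1 * fderiv ℝ w (circlePt r t) (EuclideanSpace.single 1 1)) := continuous_const.mul ((hco 0).sub (hco 1))
  have hw0 : Continuous fun t : ℝ => w (circlePt r t) := hw.continuous.comp (continuous_circlePt r)
  have hΛ : Continuous fun t : ℝ => α * (⟪gaussVortexVelocity (circlePt r t), gradient w (circlePt r t)⟫ + ⟪biotSavart2D w (circlePt r t), gradient gaussVortexProfile (circlePt r t)⟫) :=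
    continuous_const.mul ((continuous_gaussLambda hw hwc).comp (continuous_circlePt r))
  have i4 : IntervalIntegrable (fun t : ℝ => Δ w (circlePt r t) +
      1 / 2 * ((circlePt r t) 0 * fderiv ℝ w (circlePt r t) (EuclideanSpace.single 0 1) +
        (circlePt r t) 1 * fderiv ℝ w (circlePt r t) (EuclideanSpace.single 1 1)) +
      lam / 2 * ((circlePt r t) 0 * fderiv ℝ w (circlePt r t) (EuclideanSpace.single 0 1) -
        (circlePt r t) 1 * fderiv ℝ w (circlePt r t) (EuclideanSpace.single 1 1)) + w (circlePt r t)) volume (-π) π :=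
    (((hΔ.add hdr).add hst).add hw0).intervalIntegrable _ _
  have i3 : IntervalIntegrable (fun t : ℝ => Δ w (circlePt r t) +
      1 / 2 * ((circlePt r t) 0 * fderiv ℝ w (circlePt r t) (EuclideanSpace.single 0 1) +
        (circlePt r t) 1 * fderiv ℝ w (circlePt r t) (EuclideanSpace.single 1 1)) +
      lam / 2 * ((circlePt r t) 0 * fderiv ℝ w (circlePt r t) (EuclideanSpace.single 0 1) -
        (circlePt r t) 1 * fderiv ℝ w (circlePt r t) (EuclideanSpace.single 1 1))) volume (-π) π :=
    ((hΔ.add hdr).add hst).intervalIntegrable _ _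
  have i2 : IntervalIntegrable (fun t : ℝ => Δ w (circlePt r t) +
      1 / 2 * ((circlePt r t) 0 * fderiv ℝ w (circlePt r t) (EuclideanSpace.single 0 1) +
        (circlePt r t) 1 * fderiv ℝ w (circlePt r t) (EuclideanSpace.single 1 1))) volume (-π) π :=
    (hΔ.add hdr).intervalIntegrable _ _
  rw [intervalIntegral.integral_congr fun t _ => hpt (circlePt r t),
    intervalIntegral.integral_sub i4 (hΛ.intervalIntegrable _ _), intervalIntegral.integral_add i3 (hw0.intervalIntegrable _ _),
    intervalIntegral.integral_add i2 (hst.intervalIntegrable _ _),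
    intervalIntegral.integral_add (hΔ.intervalIntegrable _ _) (hdr.intervalIntegrable _ _),
    intervalIntegral.integral_const_mul, intervalIntegral.integral_const_mul, intervalIntegral.integral_const_mul,
    integral_laplacian_circlePt hw hr, integral_drift_circlePt w r, integral_strain_circlePt hw1 r,
    integral_gaussLambda_circlePt hw hwc r]
  ring

/-- **The radial ODE, integrated once**: for `0 ≤ s`,
`s M₁(s) + s² M₀(s)/2 + (λ/2) s² 𝒜(s) = ∫_0^s t F̄(t) dt` (`Φ' = rF̄`, `Φ(0) = 0`).
[cite: Maekawa2009b, §4 Lemma 4.1 (radial part)] -/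
theorem circSum_ode (hw : ContDiff ℝ 2 w) (hwc : HasCompactSupport w) (lam α : ℝ) {s : ℝ} (hs : 0 ≤ s) :
    s * (∫ θ in (-π)..π, fderiv ℝ w (circlePt s θ) (circlePt 1 θ)) + s ^ 2 / 2 * (∫ θ in (-π)..π, w (circlePt s θ)) + lam / 2 * s ^ 2 * (∫ θ in (-π)..π, Real.cos (2 * θ) * w (circlePt s θ)) = ∫ r in (0:ℝ)..s, r * (∫ θ in (-π)..π, (strainedVorticityOperator lam w (circlePt r θ) - α * (⟪gaussVortexVelocity (circlePt r θ), gradient w (circlePt r θ)⟫ + ⟪biotSavart2D w (circlePt r θ), gradient gaussVortexProfile (circlePt r θ)⟫))) := by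
  have hw1 : ContDiff ℝ 1 w := hw.of_le one_le_two
  -- the derivative of `Φ`
  have hΦ : ∀ r : ℝ, HasDerivAt (fun r : ℝ => r * (∫ θ in (-π)..π, fderiv ℝ w (circlePt r θ) (circlePt 1 θ)) + r ^ 2 / 2 * (∫ θ in (-π)..π, w (circlePt r θ)) + lam / 2 * r ^ 2 * (∫ θ in (-π)..π, Real.cos (2 * θ) * w (circlePt r θ)))
      (1 * (∫ θ in (-π)..π, fderiv ℝ w (circlePt r θ) (circlePt 1 θ)) + r * (∫ θ in (-π)..π, fderiv ℝ (fderiv ℝ w) (circlePt r θ) (circlePt 1 θ) (circlePt 1 θ)) + (2 * r / 2 * (∫ θ in (-π)..π, w (circlePt r θ)) + r ^ 2 / 2 * (∫ θ in (-π)..π, fderiv ℝ w (circlePt r θ) (circlePt 1 θ))) +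
        (lam / 2 * (2 * r) * (∫ θ in (-π)..π, Real.cos (2 * θ) * w (circlePt r θ)) + lam / 2 * r ^ 2 * (∫ θ in (-π)..π, Real.cos (2 * θ) * fderiv ℝ w (circlePt r θ) (circlePt 1 θ)))) r := by
    intro r
    have h1 := (hasDerivAt_id r).mul (hasDerivAt_circSum_fderiv hw hwc r)
    have hsq : HasDerivAt (fun r : ℝ => r ^ 2 / 2) (2 * r / 2) r := by
      simpa using (hasDerivAt_pow 2 r).div_const 2
    have hsq' : HasDerivAt (fun r : ℝ => lam / 2 * r ^ 2) (lam / 2 * (2 * r)) r := by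
      simpa using (hasDerivAt_pow 2 r).const_mul (lam / 2)
    have h2 := hsq.mul (hasDerivAt_circSum hw1 hwc r)
    have h3 := hsq'.mul (hasDerivAt_circCos hw1 hwc r)
    exact (h1.add h2).add h3
  have hFc : Continuous fun r : ℝ => (∫ θ in (-π)..π, (strainedVorticityOperator lam w (circlePt r θ) - α * (⟪gaussVortexVelocity (circlePt r θ), gradient w (circlePt r θ)⟫ + ⟪biotSavart2D w (circlePt r θ), gradient gaussVortexProfile (circlePt r θ)⟫))) := continuous_circSum' (continuous_operator hw hwc lam α)
  have hcont : Continuous fun r : ℝ => r * (∫ θ in (-π)..π, fderiv ℝ w (circlePt r θ) (circlePt 1 θ)) + r ^ 2 / 2 * (∫ θ in (-π)..π, w (circlePt r θ)) + lam / 2 * r ^ 2 * (∫ θ in (-π)..π, Real.cos (2 * θ) * w (circlePt r θ)) :=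
    continuous_iff_continuousAt.2 fun r => (hΦ r).continuousAt
  have hint : IntervalIntegrable (fun r : ℝ => r * (∫ θ in (-π)..π, (strainedVorticityOperator lam w (circlePt r θ) - α * (⟪gaussVortexVelocity (circlePt r θ), gradient w (circlePt r θ)⟫ + ⟪biotSavart2D w (circlePt r θ), gradient gaussVortexProfile (circlePt r θ)⟫)))) volume 0 s := (continuous_id.mul hFc).intervalIntegrable _ _
  have h := intervalIntegral.integral_eq_sub_of_hasDerivAt_of_le (f' := fun r : ℝ => r * (∫ θ in (-π)..π, (strainedVorticityOperator lam w (circlePt r θ) - α * (⟪gaussVortexVelocity (circlePt r θ), gradient w (circlePt r θ)⟫ + ⟪biotSavart2D w (circlePt r θ), gradient gaussVortexProfile (circlePt r θ)⟫)))) hs hcont.continuousOn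
    (fun r hr => (hΦ r).congr_deriv (by
      have hr0 : r ≠ 0 := hr.1.ne'
      rw [circSum_operator_eq hw hwc lam α hr0]
      field_simp
      ring))
    hint
  rw [h]
  simp

/-- **The explicit formula for the circular mean.** For `0 < r`,
`e^{r²/4} M₀(r) = e^{1/4} M₀(1) + ∫_1^r e^{s²/4} (𝓕(s) − (λ/2)s²𝒜(s))/s ds`, `𝓕(s) = ∫_0^s tF̄`.
[cite: Maekawa2009b, §4 Lemma 4.1 (radial part)] -/
theorem circSum_formula (hw : ContDiff ℝ 2 w) (hwc : HasCompactSupport w) (lam α : ℝ) {r : ℝ} (hr : 0 < r) :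
    Real.exp (r ^ 2 / 4) * (∫ θ in (-π)..π, w (circlePt r θ)) = Real.exp (1 / 4) * (∫ θ in (-π)..π, w (circlePt 1 θ)) +
      ∫ s in (1:ℝ)..r, Real.exp (s ^ 2 / 4) * ((∫ t in (0:ℝ)..s, t * (∫ θ in (-π)..π, (strainedVorticityOperator lam w (circlePt t θ) - α * (⟪gaussVortexVelocity (circlePt t θ), gradient w (circlePt t θ)⟫ + ⟪biotSavart2D w (circlePt t θ), gradient gaussVortexProfile (circlePt t θ)⟫)))) - lam / 2 * s ^ 2 * (∫ θ in (-π)..π, Real.cos (2 * θ) * w (circlePt s θ))) / s := by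
  have hw1 : ContDiff ℝ 1 w := hw.of_le one_le_two
  have hderiv : ∀ s : ℝ, 0 < s → HasDerivAt (fun s : ℝ => Real.exp (s ^ 2 / 4) * (∫ θ in (-π)..π, w (circlePt s θ)))
      (Real.exp (s ^ 2 / 4) * ((∫ t in (0:ℝ)..s, t * (∫ θ in (-π)..π, (strainedVorticityOperator lam w (circlePt t θ) - α * (⟪gaussVortexVelocity (circlePt t θ), gradient w (circlePt t θ)⟫ + ⟪biotSavart2D w (circlePt t θ), gradient gaussVortexProfile (circlePt t θ)⟫)))) - lam / 2 * s ^ 2 * (∫ θ in (-π)..π, Real.cos (2 * θ) * w (circlePt s θ))) / s) s := by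
    intro s hs
    have h1 : HasDerivAt (fun s : ℝ => s ^ 2 / 4) (2 * s / 4) s := by
      simpa using (hasDerivAt_pow 2 s).div_const 4
    have h := h1.exp.mul (hasDerivAt_circSum hw1 hwc s)
    refine h.congr_deriv ?_
    have hode := circSum_ode hw hwc lam α hs.le
    rw [eq_div_iff hs.ne']
    linear_combination (Real.exp (s ^ 2 / 4)) * hode
  have hFc : Continuous fun r : ℝ => (∫ θ in (-π)..π, (strainedVorticityOperator lam w (circlePt r θ) - α * (⟪gaussVortexVelocity (circlePt r θ), gradient w (circlePt r θ)⟫ + ⟪biotSavart2D w (circlePt r θ), gradient gaussVortexProfile (circlePt r θ)⟫))) := continuous_circSum' (continuous_operator hw hwc lam α)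
  have hAc : Continuous fun r : ℝ => (∫ θ in (-π)..π, Real.cos (2 * θ) * w (circlePt r θ)) :=
    continuous_circSum hw.continuous (Real.continuous_cos.comp (continuous_const.mul continuous_id))
  have hψ : IntervalIntegrable (fun s => Real.exp (s ^ 2 / 4) * ((∫ t in (0:ℝ)..s, t * (∫ θ in (-π)..π, (strainedVorticityOperator lam w (circlePt t θ) - α * (⟪gaussVortexVelocity (circlePt t θ), gradient w (circlePt t θ)⟫ + ⟪biotSavart2D w (circlePt t θ), gradient gaussVortexProfile (circlePt t θ)⟫)))) - lam / 2 * s ^ 2 * (∫ θ in (-π)..π, Real.cos (2 * θ) * w (circlePt s θ))) / s)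
      volume 1 r := by
    refine ((continuousOn_radialPsi hFc hAc lam).mono fun s hs => ?_).intervalIntegrable
    rcases le_total 1 r with h | h
    · rw [uIcc_of_le h] at hs; exact lt_of_lt_of_le zero_lt_one hs.1
    · rw [uIcc_of_ge h] at hs; exact lt_of_lt_of_le hr hs.1
  have h := intervalIntegral.integral_eq_sub_of_hasDerivAt (fun s hs => hderiv s (by
      rcases le_total 1 r with h | h
      · rw [uIcc_of_le h] at hs; exact lt_of_lt_of_le zero_lt_one hs.1
      · rw [uIcc_of_ge h] at hs; exact lt_of_lt_of_le hr hs.1)) hψ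
  rw [h]
  norm_num

/-! ### Support radius, flux and mass -/

/-- A radius `R ≥ 1` beyond the support of `w ∈ C¹_c`: `w` and `Dw` vanish on `{‖y‖ ≥ R}`. [folklore] -/
theorem exists_radius_one_le (hwc : HasCompactSupport w) :
    ∃ R : ℝ, 1 ≤ R ∧ (∀ y, R ≤ ‖y‖ → w y = 0) ∧ ∀ (v : EuclideanSpace ℝ (Fin 2)) (y), R ≤ ‖y‖ → fderiv ℝ w y v = 0 := by
  obtain ⟨R₀, hR₀, h0, h1, -⟩ := exists_support_radius hwc (w := w)
  exact ⟨R₀ + 1, by linarith, fun y hy => h0 y (by linarith), fun v y hy => h1 v y (by linarith)⟩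

/-- **Zero total flux**: `∫_0^R t F̄(t) dt = 0` for `R ≥ 0` beyond the support of `w`.
[cite: Maekawa2009b, §4 Lemma 4.1 (radial part)] -/
theorem circSum_flux_eq_zero (hw : ContDiff ℝ 2 w) (hwc : HasCompactSupport w) (lam α : ℝ) {R : ℝ} (hR : 0 ≤ R)
    (h0 : ∀ y, R ≤ ‖y‖ → w y = 0) (h1 : ∀ (v : EuclideanSpace ℝ (Fin 2)) (y), R ≤ ‖y‖ → fderiv ℝ w y v = 0) :
    ∫ r in (0:ℝ)..R, r * (∫ θ in (-π)..π, (strainedVorticityOperator lam w (circlePt r θ) - α * (⟪gaussVortexVelocity (circlePt r θ), gradient w (circlePt r θ)⟫ + ⟪biotSavart2D w (circlePt r θ), gradient gaussVortexProfile (circlePt r θ)⟫))) = 0 := by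
  have hn : ∀ t : ℝ, R ≤ ‖circlePt R t‖ := fun t => by rw [norm_circlePt, abs_of_nonneg hR]
  rw [← circSum_ode hw hwc lam α hR]
  simp [h0 _ (hn _), h1 _ _ (hn _)]

/-- **Polar coordinates with circular sums.** For an integrable `G`,
`∫ G = ∫_{r > 0} r ∫_{-π}^{π} G(circlePt r t) dt dr`. [folklore] -/
theorem integral_eq_setIntegral_mul_circSum {G : EuclideanSpace ℝ (Fin 2) → ℝ} (hG : Integrable G) :
    ∫ x, G x = ∫ r in Ioi (0:ℝ), r * ∫ t in (-π)..π, G (circlePt r t) := by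
  rw [integral_eq_integral_circlePt hG]
  refine setIntegral_congr_fun measurableSet_Ioi fun r _ => ?_
  simp_rw [smul_eq_mul]
  rw [integral_const_mul, intervalIntegral.integral_of_le (by linarith [Real.pi_pos])]

/-- The radial function `r ↦ r ∫ G(circlePt r t) dt` is integrable on `(0, ∞)` for integrable `G`. [folklore] -/
theorem integrableOn_mul_circSum {G : EuclideanSpace ℝ (Fin 2) → ℝ} (hG : Integrable G) :
    IntegrableOn (fun r : ℝ => r * ∫ t in (-π)..π, G (circlePt r t)) (Ioi 0) := by
  have h := (integrable_circlePt_smul hG).integral_prod_left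
  refine h.congr (ae_of_all _ fun r => ?_)
  simp_rw [smul_eq_mul]
  rw [integral_const_mul, intervalIntegral.integral_of_le (by linarith [Real.pi_pos])]

/-- Truncation of a radial integral beyond the support. [folklore] -/
theorem setIntegral_Ioi_eq_intervalIntegral_of_vanishing {h : ℝ → ℝ} (hh : Continuous h) {R : ℝ} (hR : 0 ≤ R)
    (hz : ∀ r, R < r → h r = 0) : ∫ r in Ioi (0:ℝ), h r = ∫ r in (0:ℝ)..R, h r := by
  have hI : IntegrableOn h (Ioi R) :=
    (integrableOn_zero (s := Ioi R)).congr_fun (fun r hr => (hz r hr).symm) measurableSet_Ioi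
  rw [← Ioc_union_Ioi_eq_Ioi hR, setIntegral_union (Ioc_disjoint_Ioi le_rfl) measurableSet_Ioi
    (hh.integrableOn_Icc.mono_set Ioc_subset_Icc_self) hI,
    setIntegral_eq_zero_of_forall_eq_zero (t := Ioi R) fun r hr => hz r hr,
    add_zero, intervalIntegral.integral_of_le hR]

/-- **Mass in polar form**: `∫ w = ∫_0^R r M₀(r) dr` for `R ≥ 0` beyond the support. [folklore] -/
theorem integral_eq_integral_mul_circSum (hw : ContDiff ℝ 2 w) (hwc : HasCompactSupport w) {R : ℝ} (hR : 0 ≤ R)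
    (h0 : ∀ y, R ≤ ‖y‖ → w y = 0) : ∫ x, w x = ∫ r in (0:ℝ)..R, r * (∫ θ in (-π)..π, w (circlePt r θ)) := by
  rw [integral_eq_setIntegral_mul_circSum (hw.continuous.integrable_of_hasCompactSupport hwc)]
  refine setIntegral_Ioi_eq_intervalIntegral_of_vanishing (continuous_id.mul (continuous_circSum' hw.continuous)) hR fun r hr => ?_
  have hn : ∀ t : ℝ, R ≤ ‖circlePt r t‖ := fun t => by
    rw [norm_circlePt]; exact hr.le.trans (le_abs_self r)
  simp [h0 _ (hn _)]

/-- **The radial package.** For `w ∈ C²_c(ℝ²)` and `f = L_λw − αΛw` there are `R ≥ 1` (beyond the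
support) and `c` such that the circular sums `M₀ = ∫ w∘circlePt`, `F̄ = ∫ f∘circlePt`,
`𝒜 = ∫ cos 2t · w∘circlePt` are continuous, `∫_0^R tF̄ = 0`, `∫ w = ∫_0^R r M₀`, and
`e^{r²/4}M₀(r) = c + ∫_1^r e^{s²/4}(∫_0^s tF̄ − (λ/2)s²𝒜(s))/s ds` for `r > 0` — the hypotheses of
`radialMean_weighted_sq_le`. [cite: Maekawa2009b, §4 Lemma 4.1 (radial part)] -/
theorem radialMean_package (hw : ContDiff ℝ 2 w) (hwc : HasCompactSupport w) (lam α : ℝ) :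
    ∃ R c : ℝ, 1 ≤ R ∧ (∀ y, R ≤ ‖y‖ → w y = 0) ∧
      Continuous (fun r : ℝ => (∫ θ in (-π)..π, w (circlePt r θ))) ∧ Continuous (fun r : ℝ => (∫ θ in (-π)..π, (strainedVorticityOperator lam w (circlePt r θ) - α * (⟪gaussVortexVelocity (circlePt r θ), gradient w (circlePt r θ)⟫ + ⟪biotSavart2D w (circlePt r θ), gradient gaussVortexProfile (circlePt r θ)⟫)))) ∧ Continuous (fun r : ℝ => (∫ θ in (-π)..π, Real.cos (2 * θ) * w (circlePt r θ))) ∧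
      (∫ r in (0:ℝ)..R, r * (∫ θ in (-π)..π, (strainedVorticityOperator lam w (circlePt r θ) - α * (⟪gaussVortexVelocity (circlePt r θ), gradient w (circlePt r θ)⟫ + ⟪biotSavart2D w (circlePt r θ), gradient gaussVortexProfile (circlePt r θ)⟫))) = 0) ∧ (∫ x, w x = ∫ r in (0:ℝ)..R, r * (∫ θ in (-π)..π, w (circlePt r θ))) ∧
      ∀ r, 0 < r → Real.exp (r ^ 2 / 4) * (∫ θ in (-π)..π, w (circlePt r θ)) =
        c + ∫ s in (1:ℝ)..r, Real.exp (s ^ 2 / 4) * ((∫ t in (0:ℝ)..s, t * (∫ θ in (-π)..π, (strainedVorticityOperator lam w (circlePt t θ) - α * (⟪gaussVortexVelocity (circlePt t θ), gradient w (circlePt t θ)⟫ + ⟪biotSavart2D w (circlePt t θ), gradient gaussVortexProfile (circlePt t θ)⟫)))) - lam / 2 * s ^ 2 * (∫ θ in (-π)..π, Real.cos (2 * θ) * w (circlePt s θ))) / s := by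
  obtain ⟨R, hR1, h0, h1⟩ := exists_radius_one_le hwc
  refine ⟨R, Real.exp (1 / 4) * (∫ θ in (-π)..π, w (circlePt 1 θ)), hR1, h0, continuous_circSum' hw.continuous,
    continuous_circSum' (continuous_operator hw hwc lam α),
    continuous_circSum hw.continuous (Real.continuous_cos.comp (continuous_const.mul continuous_id)),
    circSum_flux_eq_zero hw hwc lam α (by linarith) h0 h1, integral_eq_integral_mul_circSum hw hwc (by linarith) h0,
    fun r hr => circSum_formula hw hwc lam α hr⟩

end Sums

end Literature.Analysis.FluidPDE
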